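import Literature.NumberTheory.Automorphic.UnitaryFormGroupUnimodular
import Literature.NumberTheory.Automorphic.UnitaryGroupArchimedeanPlaces
import Literature.NumberTheory.Automorphic.LocalUnitaryGroupCongr
import Literature.NumberTheory.Rogawski1990.ArchOrbitalMeasureRegular
import HarnessLib

/-!
# `U(H)(L ⊗ ℝ)` is unimodular; archimedean orbital measures at the regular classes, unconditionally (Knapp (2002), Cor. 8.31;
# Rogawski (1990), §14.2–14.3)

Topic `NumberTheory/Automorphic` (CM dress of ★ `UnitaryFormGroupUnimodular`; ENGINE T1 of the cell `hodgecm-mathlib`, «ARCH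
UNIMODULARITY» U2); namespaces `Literature.NumberTheory.Automorphic` (§1), `….UnitaryGroup` (§2), `Literature.NumberTheory.Rogawski1990` (§3).
THEOREMS ONLY (no definition, no named fact, no instance, no notation).

For a CM field `L` (`c` = complex conjugation) and a `c`-hermitian non-degenerate `H ∈ M_N(L)` the real group
`G_∞ = U(H)(L⁺ ⊗ ℝ) = UnitaryGroup.arch L⁺ L c N H` factors as `Π_{w complex} U(σ_w H)(ℂ)` (★ `UnitaryGroup.archPiEquivCM`), each
`σ_w H ∈ M_N(ℂ)` being hermitian non-degenerate; so `Δ_{G_∞} ≡ 1`: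
* §1 `modularCharacterFun_pi_eq_one` — a FINITE PRODUCT of unimodular (second countable, locally compact) groups is unimodular (the
  product of right-invariant Haar measures is a right-invariant Haar measure; ★ `modularCharacterFun_prod_eq_one` is the binary case);
* §2 `UnitaryGroup.isHermitian_map_embedding` (`σ_w ∘ c = conj ∘ σ_w`), `UnitaryGroup.modularCharacterFun_archLocal_eq_one` (★
  `modularCharacterFun_unitaryGroupOfForm_eq_one`), **`UnitaryGroup.modularCharacterFun_arch_eq_one`** (transport along `archPiEquivCM`, ★
  `modularCharacterFun_eq_one_of_continuousMulEquiv`), the endoscopic product `modularCharacterFun_arch_prod_eq_one`, and the instances of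
  the cell: `G′_∞ = U(H′)_∞` (`H′` anisotropic), `G_∞ = U(Φ₃)_∞`, `H_∞ = U(Φ₂)_∞ × U(Φ₁)_∞` (`…_antidiagOne`, `…_endoscopic`);
* §3 the hypothesis `hΔ` of ★ `Rogawski1990.exists_isAdmissibleOn_isRegularElt_arch_of_unimodular` discharged:
  **`Rogawski1990.exists_isAdmissibleOn_isRegularElt_arch`** — on `U(H)(L⁺ ⊗ ℝ)` an orbital measure family ADMISSIBLE ON THE REGULAR
  CLASSES exists (the `m′_∞`, `m_∞` of the named facts `ArchInnerTransferExists` ∕ `ArchTransfersExist`), for every `c`-hermitian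
  non-degenerate `H`, in particular for `H′` anisotropic and for `Φ₃`.

## References
* A. W. Knapp, *Lie Groups Beyond an Introduction*, 2nd ed. (2002), VIII.§2 Cor. 8.31 [Knapp2002].
* G. B. Folland, *A Course in Abstract Harmonic Analysis* (1995), §2.4 Prop. 2.27 [Folland1995].
* J. Rogawski, *Automorphic Representations of Unitary Groups in Three Variables* (1990), §14.2 (14.2.1)–(14.2.2) pp. 232–233, §14.3
  p. 234, §4.9 p. 54 [Rogawski1990].
* A. Borel, H. Jacquet, PSPM 33.1 (1979), §4.1 [BorelJacquet1979].
-/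

set_option autoImplicit false

noncomputable section

open MeasureTheory Measure NumberField NumberField.InfinitePlace
open scoped Matrix MatrixGroups NNReal

namespace Literature.NumberTheory.Automorphic

/-! ## §1 Finite products of unimodular groups -/

section Pi

variable {ι : Type*} [Fintype ι] {G : ι → Type*} [∀ i, Group (G i)] [∀ i, TopologicalSpace (G i)]
  [∀ i, IsTopologicalGroup (G i)] [∀ i, LocallyCompactSpace (G i)] [∀ i, SecondCountableTopology (G i)]

/-- **A finite product of unimodular groups is unimodular**: `Δ_{Π G_i} ≡ 1` when every `Δ_{G_i} ≡ 1` (second countable locally compact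
factors): the product of the right-invariant Haar measures is a right-invariant Haar measure on `Π i, G i`.
[cite: Folland1995, §2.4 Prop. 2.27] -/
theorem modularCharacterFun_pi_eq_one (h : ∀ i, ∀ g : G i, modularCharacterFun g = 1) (g : ∀ i, G i) :
    modularCharacterFun g = 1 := by
  letI : ∀ i, MeasurableSpace (G i) := fun i => borel (G i)
  haveI : ∀ i, BorelSpace (G i) := fun i => ⟨rfl⟩
  haveI : ∀ i, (haar : Measure (G i)).IsMulRightInvariant := fun i =>
    isMulRightInvariant_of_modularCharacterFun_eq_one (h i) _
  exact modularCharacterFun_eq_one_of_isMulRightInvariant (Measure.pi fun i => (haar : Measure (G i))) g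

end Pi

/-! ## §2 The archimedean unitary groups of a CM hermitian space -/

namespace UnitaryGroup

section Local

variable (L : Type) [Field L] [NumberField L] [IsCMField L] {N : ℕ}

/-- At a complex embedding `τ` of the CM field `L`, a `c`-hermitian `H` (`ᵗ(c H) = H`) becomes a HERMITIAN complex matrix `τ(H)`
(`τ ∘ c = conj ∘ τ`, ★ `embedding_cmConjRingHom`). [cite: BorelJacquet1979, §4.1] -/
theorem isHermitian_map_embedding {m : Type*} {H : Matrix m m L} (hherm : (H.map (cmConjRingHom L))ᵀ = H) (τ : L →+* ℂ) :
    (H.map τ).IsHermitian := by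
  refine Matrix.IsHermitian.ext fun i j => ?_
  have h : cmConjRingHom L (H j i) = H i j := by
    have h0 := congrFun (congrFun hherm i) j
    simpa only [Matrix.transpose_apply, Matrix.map_apply] using h0
  rw [Matrix.map_apply, Matrix.map_apply, ← h, embedding_cmConjRingHom, Complex.star_def]

omit [NumberField L] [IsCMField L] in
/-- `det τ(H) = τ(det H) ≠ 0` for a non-degenerate `H`. [cite: BorelJacquet1979, §4.1] -/
theorem det_map_embedding_ne_zero {m : Type*} [Fintype m] [DecidableEq m] {H : Matrix m m L} (hdet : H.det ≠ 0) (τ : L →+* ℂ) :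
    (H.map τ).det ≠ 0 := by
  have h : (H.map τ).det = τ H.det := (RingHom.map_det τ H).symm
  rw [h]
  exact (map_ne_zero τ).2 hdet

variable (H : Matrix (Fin N) (Fin N) L)

/-- **`U(σ_w H)(ℂ) ≅ U(p, q)` is unimodular**: `Δ ≡ 1` on the local archimedean factor `archLocal L N H w` of a `c`-hermitian
non-degenerate `H` (★ `modularCharacterFun_unitaryGroupOfForm_eq_one` at the hermitian non-degenerate `σ_w H`).
[cite: Knapp2002, VIII.§2 Cor. 8.31] -/
theorem modularCharacterFun_archLocal_eq_one (hherm : (H.map (cmConjRingHom L))ᵀ = H) (hdet : H.det ≠ 0)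
    (w : {w : InfinitePlace L // IsComplex w}) [LocallyCompactSpace (archLocal L N H w)] (g : archLocal L N H w) :
    modularCharacterFun g = 1 := by
  haveI : LocallyCompactSpace (unitaryGroupOfForm (starRingEnd ℂ) (H.map w.1.embedding)) := ‹LocallyCompactSpace (archLocal L N H w)›
  exact modularCharacterFun_unitaryGroupOfForm_eq_one (isHermitian_map_embedding L hherm w.1.embedding)
    (det_map_embedding_ne_zero L hdet w.1.embedding) g

end Local

section Arch

variable (L : Type) [Field L] [NumberField L] [IsCMField L] {N : ℕ} (H : Matrix (Fin N) (Fin N) L)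

/-- **`G_∞ = U(H)(L⁺ ⊗ ℝ)` is unimodular**: `Δ ≡ 1` on `UnitaryGroup.arch L⁺ L c N H` for every `c`-hermitian non-degenerate `H ∈ M_N(L)`
— transport along `U(H)(L ⊗ ℝ) ≃ₜ* Π_w U(σ_w H)(ℂ)` (★ `archPiEquivCM`) of the product (§1) of the local statements
(`modularCharacterFun_archLocal_eq_one`); reductive real groups are unimodular. [cite: Knapp2002, VIII.§2 Cor. 8.31]
[cite: BorelJacquet1979, §4.1] -/
theorem modularCharacterFun_arch_eq_one (hherm : (H.map (cmConjRingHom L))ᵀ = H) (hdet : H.det ≠ 0)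
    (g : arch (↥(maximalRealSubfield L)) L (IsCMField.complexConj L) N H) : modularCharacterFun g = 1 := by
  classical
  -- (the same instances as ★ `UnitaryGroup.locallyCompactSpace_archLocal` ∕ `secondCountableTopology_archLocal` of
  -- ★ `ArchLocalRegularOrbitClosed`, obtained here from the generic `U(⋆, H)(ℂ)` statements of ★ `UnitaryFormGroupUnimodular`)
  haveI : ∀ w : {w : InfinitePlace L // IsComplex w}, LocallyCompactSpace (archLocal L N H w) :=
    fun w => locallyCompactSpace_unitaryGroupOfForm_complex (H.map w.1.embedding)
  haveI : ∀ w : {w : InfinitePlace L // IsComplex w}, SecondCountableTopology (archLocal L N H w) :=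
    fun w => secondCountableTopology_unitaryGroupOfForm_complex (H.map w.1.embedding)
  exact modularCharacterFun_eq_one_of_continuousMulEquiv (archPiEquivCM N L H)
    (modularCharacterFun_pi_eq_one fun w k => modularCharacterFun_archLocal_eq_one L H hherm hdet w k) g

/-- The same in the `modularCharacter` (homomorphism) spelling. [cite: Knapp2002, VIII.§2 Cor. 8.31] -/
theorem modularCharacter_arch_eq_one (hherm : (H.map (cmConjRingHom L))ᵀ = H) (hdet : H.det ≠ 0)
    (g : arch (↥(maximalRealSubfield L)) L (IsCMField.complexConj L) N H) : modularCharacter g = 1 :=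
  modularCharacterFun_arch_eq_one L H hherm hdet g

/-- **A product `U(H₁)(L⁺ ⊗ ℝ) × U(H₂)(L⁺ ⊗ ℝ)` is unimodular** (e.g. the endoscopic `H_∞ = U(Φ₂)_∞ × U(Φ₁)_∞`; ★
`modularCharacterFun_prod_eq_one`). [cite: Knapp2002, VIII.§2 Cor. 8.31] [cite: Folland1995, §2.4 Prop. 2.27] -/
theorem modularCharacterFun_arch_prod_eq_one {N₁ N₂ : ℕ} (H₁ : Matrix (Fin N₁) (Fin N₁) L) (H₂ : Matrix (Fin N₂) (Fin N₂) L)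
    (hherm₁ : (H₁.map (cmConjRingHom L))ᵀ = H₁) (hdet₁ : H₁.det ≠ 0) (hherm₂ : (H₂.map (cmConjRingHom L))ᵀ = H₂) (hdet₂ : H₂.det ≠ 0)
    (g : arch (↥(maximalRealSubfield L)) L (IsCMField.complexConj L) N₁ H₁ × arch (↥(maximalRealSubfield L)) L (IsCMField.complexConj L) N₂ H₂) :
    modularCharacterFun g = 1 :=
  modularCharacterFun_prod_eq_one (modularCharacterFun_arch_eq_one L H₁ hherm₁ hdet₁) (modularCharacterFun_arch_eq_one L H₂ hherm₂ hdet₂) g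

/-- **`G_∞ = U(Φ_N)(L⁺ ⊗ ℝ)` (quasi-split form `Φ_N = antidiag(1, …, 1)`) is unimodular** (★ `antidiagOne_isHermitian`, ★
`isUnit_antidiagOne_det`). [cite: Knapp2002, VIII.§2 Cor. 8.31] [cite: Rogawski1990, §14.2 (14.2.1) p. 232] -/
theorem modularCharacterFun_arch_antidiagOne_eq_one (N : ℕ)
    (g : arch (↥(maximalRealSubfield L)) L (IsCMField.complexConj L) N
      (Matrix.of fun i j : Fin N => if i.val + j.val + 1 = N then (1 : L) else 0)) :
    modularCharacterFun g = 1 :=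
  modularCharacterFun_arch_eq_one L _ (antidiagOne_isHermitian L N) (isUnit_antidiagOne_det L N).ne_zero g

/-- **`H_∞ = U(Φ₂)(L⁺ ⊗ ℝ) × U(Φ₁)(L⁺ ⊗ ℝ)` (the archimedean endoscopic group) is unimodular.** [cite: Knapp2002, VIII.§2 Cor. 8.31]
[cite: Rogawski1990, §14.3 p. 234] -/
theorem modularCharacterFun_arch_endoscopic_eq_one
    (g : arch (↥(maximalRealSubfield L)) L (IsCMField.complexConj L) 2
          (Matrix.of fun i j : Fin 2 => if i.val + j.val + 1 = 2 then (1 : L) else 0) ×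
        arch (↥(maximalRealSubfield L)) L (IsCMField.complexConj L) 1
          (Matrix.of fun i j : Fin 1 => if i.val + j.val + 1 = 1 then (1 : L) else 0)) :
    modularCharacterFun g = 1 :=
  modularCharacterFun_arch_prod_eq_one L _ _ (antidiagOne_isHermitian L 2) (isUnit_antidiagOne_det L 2).ne_zero
    (antidiagOne_isHermitian L 1) (isUnit_antidiagOne_det L 1).ne_zero g

end Arch

end UnitaryGroup

end Literature.NumberTheory.Automorphic

/-! ## §3 Archimedean orbital measures at the regular classes — unconditionally -/

namespace Literature.NumberTheory.Rogawski1990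

open Literature.NumberTheory.Automorphic

variable (L : Type) [Field L] [NumberField L] [IsCMField L] {N : ℕ}

/-- **Archimedean orbital measures on the regular classes of `G_∞ = U(H)(L⁺ ⊗ ℝ)`, UNCONDITIONALLY**: for every `c`-hermitian
non-degenerate `H ∈ M_N(L)` there is an orbital measure family `m_∞` on `U(H)(L⁺ ⊗ ℝ)` ADMISSIBLE ON THE REGULAR CLASSES — each member
nonzero, `G_∞`-invariant and finite on compacta (★ `exists_isAdmissibleOn_isRegularElt_arch_of_unimodular` with its hypothesis `hΔ`
discharged by `UnitaryGroup.modularCharacterFun_arch_eq_one`). The measures `dġ` of (14.2.1)–(14.2.2) on `G′_∞ = U(H′)_∞` (`H′`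
anisotropic) and `G_∞ = U(Φ₃)_∞`. [cite: Rogawski1990, §14.2 (14.2.1) p. 232; §4.9 p. 54] [cite: DeitmarEchterhoff2014, Thm. 1.5.3] -/
theorem exists_isAdmissibleOn_isRegularElt_arch (H : Matrix (Fin N) (Fin N) L)
    [MeasurableSpace (UnitaryGroup.arch (↥(maximalRealSubfield L)) L (IsCMField.complexConj L) N H)]
    [BorelSpace (UnitaryGroup.arch (↥(maximalRealSubfield L)) L (IsCMField.complexConj L) N H)]
    [∀ γ : UnitaryGroup.arch (↥(maximalRealSubfield L)) L (IsCMField.complexConj L) N H,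
      MeasurableSpace (UnitaryGroup.arch (↥(maximalRealSubfield L)) L (IsCMField.complexConj L) N H ⧸
        Subgroup.centralizer ({γ} : Set (UnitaryGroup.arch (↥(maximalRealSubfield L)) L (IsCMField.complexConj L) N H)))]
    [∀ γ : UnitaryGroup.arch (↥(maximalRealSubfield L)) L (IsCMField.complexConj L) N H,
      BorelSpace (UnitaryGroup.arch (↥(maximalRealSubfield L)) L (IsCMField.complexConj L) N H ⧸
        Subgroup.centralizer ({γ} : Set (UnitaryGroup.arch (↥(maximalRealSubfield L)) L (IsCMField.complexConj L) N H)))]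
    (hherm : (H.map (cmConjRingHom L))ᵀ = H) (hdet : H.det ≠ 0) :
    ∃ m : OrbitalMeasureFamily (UnitaryGroup.arch (↥(maximalRealSubfield L)) L (IsCMField.complexConj L) N H),
      m.IsAdmissibleOn fun γ => IsRegularElt (γ.val : GL (Fin N) (mixedEmbedding.mixedSpace L)) :=
  exists_isAdmissibleOn_isRegularElt_arch_of_unimodular L H (UnitaryGroup.modularCharacterFun_arch_eq_one L H hherm hdet)

/-- The same with the REGULARITY of the members recorded (`(m c).Regular` at every regular class).
[cite: Rogawski1990, §14.3 p. 234] [cite: DeitmarEchterhoff2014, Thm. 1.5.3] -/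
theorem exists_orbitalMeasureFamily_isRegularElt_arch (H : Matrix (Fin N) (Fin N) L)
    [MeasurableSpace (UnitaryGroup.arch (↥(maximalRealSubfield L)) L (IsCMField.complexConj L) N H)]
    [BorelSpace (UnitaryGroup.arch (↥(maximalRealSubfield L)) L (IsCMField.complexConj L) N H)]
    [∀ γ : UnitaryGroup.arch (↥(maximalRealSubfield L)) L (IsCMField.complexConj L) N H,
      MeasurableSpace (UnitaryGroup.arch (↥(maximalRealSubfield L)) L (IsCMField.complexConj L) N H ⧸
        Subgroup.centralizer ({γ} : Set (UnitaryGroup.arch (↥(maximalRealSubfield L)) L (IsCMField.complexConj L) N H)))]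
    [∀ γ : UnitaryGroup.arch (↥(maximalRealSubfield L)) L (IsCMField.complexConj L) N H,
      BorelSpace (UnitaryGroup.arch (↥(maximalRealSubfield L)) L (IsCMField.complexConj L) N H ⧸
        Subgroup.centralizer ({γ} : Set (UnitaryGroup.arch (↥(maximalRealSubfield L)) L (IsCMField.complexConj L) N H)))]
    (hherm : (H.map (cmConjRingHom L))ᵀ = H) (hdet : H.det ≠ 0) :
    ∃ m : OrbitalMeasureFamily (UnitaryGroup.arch (↥(maximalRealSubfield L)) L (IsCMField.complexConj L) N H),
      ∀ c : ConjClasses (UnitaryGroup.arch (↥(maximalRealSubfield L)) L (IsCMField.complexConj L) N H),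
        IsRegularElt ((Quotient.out c).val : GL (Fin N) (mixedEmbedding.mixedSpace L)) →
          m c ≠ 0 ∧ SMulInvariantMeasure (UnitaryGroup.arch (↥(maximalRealSubfield L)) L (IsCMField.complexConj L) N H)
            (UnitaryGroup.arch (↥(maximalRealSubfield L)) L (IsCMField.complexConj L) N H ⧸
              Subgroup.centralizer ({(Quotient.out c : UnitaryGroup.arch (↥(maximalRealSubfield L)) L (IsCMField.complexConj L) N H)} :
                Set (UnitaryGroup.arch (↥(maximalRealSubfield L)) L (IsCMField.complexConj L) N H))) (m c) ∧
          (m c).Regular ∧ IsFiniteMeasureOnCompacts (m c) :=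
  exists_orbitalMeasureFamily_isRegularElt_arch_of_unimodular L H (UnitaryGroup.modularCharacterFun_arch_eq_one L H hherm hdet)

/-- **`G_∞ = U(Φ₃)(L⁺ ⊗ ℝ)`**: an orbital measure family admissible on the regular classes exists (the `m_∞` of `ArchTransfersExist`).
[cite: Rogawski1990, §14.2 (14.2.1) p. 232; §4.9 p. 54] [cite: DeitmarEchterhoff2014, Thm. 1.5.3] -/
theorem exists_isAdmissibleOn_isRegularElt_arch_antidiagOne (N : ℕ)
    [MeasurableSpace (UnitaryGroup.arch (↥(maximalRealSubfield L)) L (IsCMField.complexConj L) N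
      (Matrix.of fun i j : Fin N => if i.val + j.val + 1 = N then (1 : L) else 0))]
    [BorelSpace (UnitaryGroup.arch (↥(maximalRealSubfield L)) L (IsCMField.complexConj L) N
      (Matrix.of fun i j : Fin N => if i.val + j.val + 1 = N then (1 : L) else 0))]
    [∀ γ : UnitaryGroup.arch (↥(maximalRealSubfield L)) L (IsCMField.complexConj L) N
        (Matrix.of fun i j : Fin N => if i.val + j.val + 1 = N then (1 : L) else 0),
      MeasurableSpace (UnitaryGroup.arch (↥(maximalRealSubfield L)) L (IsCMField.complexConj L) N
          (Matrix.of fun i j : Fin N => if i.val + j.val + 1 = N then (1 : L) else 0) ⧸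
        Subgroup.centralizer ({γ} : Set (UnitaryGroup.arch (↥(maximalRealSubfield L)) L (IsCMField.complexConj L) N
          (Matrix.of fun i j : Fin N => if i.val + j.val + 1 = N then (1 : L) else 0))))]
    [∀ γ : UnitaryGroup.arch (↥(maximalRealSubfield L)) L (IsCMField.complexConj L) N
        (Matrix.of fun i j : Fin N => if i.val + j.val + 1 = N then (1 : L) else 0),
      BorelSpace (UnitaryGroup.arch (↥(maximalRealSubfield L)) L (IsCMField.complexConj L) N
          (Matrix.of fun i j : Fin N => if i.val + j.val + 1 = N then (1 : L) else 0) ⧸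
        Subgroup.centralizer ({γ} : Set (UnitaryGroup.arch (↥(maximalRealSubfield L)) L (IsCMField.complexConj L) N
          (Matrix.of fun i j : Fin N => if i.val + j.val + 1 = N then (1 : L) else 0))))] :
    ∃ m : OrbitalMeasureFamily (UnitaryGroup.arch (↥(maximalRealSubfield L)) L (IsCMField.complexConj L) N
        (Matrix.of fun i j : Fin N => if i.val + j.val + 1 = N then (1 : L) else 0)),
      m.IsAdmissibleOn fun γ => IsRegularElt (γ.val : GL (Fin N) (mixedEmbedding.mixedSpace L)) :=
  exists_isAdmissibleOn_isRegularElt_arch L _ (UnitaryGroup.antidiagOne_isHermitian L N)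
    (UnitaryGroup.isUnit_antidiagOne_det L N).ne_zero

end Literature.NumberTheory.Rogawski1990

end
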